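import Mathlib
import Literature.Analysis.Pluripotential.SubharmonicMaxPrinciple
import HarnessLib

/-!
# Boundary minorisation of subharmonic functions in the right half-plane (Poisson kernel form)

Topic `Literature/Analysis/Potential`. Classical potential theory in the half-plane
`{Re z > 0}`, in the tree's `[-∞, +∞)`-valued `IsSubharmonicOn` language
(`Literature/Analysis/Pluripotential/Plurisubharmonic.lean`): if `u ≤ 0` on the closed right
half-plane, `u(x) ≥ -xβ` on the positive real axis, and the Cayley pull-backs
`ζ ↦ u(x(1+ζ)/(1-ζ))` (`x > 0`) are subharmonic on the disc (off the pole `ζ = 1`), then the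
boundary trace satisfies `∫_ℝ (-u(iy)) y⁻² dy ≤ π β` (`lintegral_boundary_le_of_subharmonic`).
This is the `x → 0⁺` limit of the Poisson-integral minorisation
`u(x) ≤ (1/π) ∫ u(iy) x (x²+y²)⁻¹ dy` (Ransford, *Potential Theory in the Complex Plane* (1995),
§2.4, sub-mean-value inequality transported by the Cayley map; Koosis, *The Logarithmic Integral*
I, Ch. III for the half-plane Poisson kernel), obtained here directly: sub-mean-value inequality at
the centre of the circles `|ζ| = r < 1`, Fatou's lemma as `r → 1` (upper semicontinuity at the
boundary), the change of variables `y = x cot(θ/2)` (`lintegral_cayley_subst`, the Poisson kernel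
`2x/(x²+y²)` as image of arc length), and monotone convergence in `x`.

Also: `cayley_boundary` (`(1+e^{iθ})/(1-e^{iθ}) = i cot(θ/2)`), `re_cayley_nonneg`,
`hasDerivAt_mul_cot_half`. Written for route `HubbardSuperconductivity/KkFloor` (the
Kramers–Kronig floor `KkFloorTheorem`, applied to the superharmonic spectral abscissa of a matrix
pencil). No definitions; all statements are folklore real/complex analysis.
-/

noncomputable section

open Complex MeasureTheory Set Filter Metric
open scoped Real Topology ENNReal
open Literature.Analysis.Pluripotential

namespace Literature.Analysis.Potential


/-- Boundary values of the Cayley map `ζ ↦ (1+ζ)/(1-ζ)` of the unit disc onto the right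
half-plane: `(1 + e^{iθ})/(1 - e^{iθ}) = i cot(θ/2)`. [folklore] -/
theorem cayley_boundary (θ : ℝ) (hθ : Real.sin (θ / 2) ≠ 0) :
    (1 + exp (θ * I)) / (1 - exp (θ * I)) = I * ((Real.cos (θ / 2) / Real.sin (θ / 2) : ℝ) : ℂ) := by
  set c := Real.cos (θ / 2) with hc
  set s := Real.sin (θ / 2) with hs
  have hcs : s ^ 2 + c ^ 2 = 1 := Real.sin_sq_add_cos_sq _
  have hcos : Real.cos θ = 2 * c ^ 2 - 1 := by
    conv_lhs => rw [show θ = 2 * (θ / 2) by ring]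
    rw [Real.cos_two_mul]
  have hsin : Real.sin θ = 2 * s * c := by
    conv_lhs => rw [show θ = 2 * (θ / 2) by ring]
    rw [Real.sin_two_mul]
  have hE : exp (θ * I) = ((2 * c ^ 2 - 1 : ℝ) : ℂ) + ((2 * s * c : ℝ) : ℂ) * I := by
    rw [Complex.exp_mul_I, ← Complex.ofReal_cos, ← Complex.ofReal_sin, hcos, hsin]
  have hden : (1 : ℂ) - exp (θ * I) ≠ 0 := by
    rw [hE]
    intro h0
    have h1 := congrArg Complex.re h0
    simp only [Complex.sub_re, Complex.one_re, Complex.add_re, Complex.ofReal_re, Complex.mul_re,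
      Complex.I_re, mul_zero, Complex.ofReal_im, Complex.I_im, zero_mul, sub_zero, add_zero,
      Complex.zero_re] at h1
    have h2 : s ^ 2 = 0 := by nlinarith
    exact hθ (pow_eq_zero_iff two_ne_zero |>.mp h2)
  rw [div_eq_iff hden, hE]
  have hcs' : c ^ 2 = 1 - s ^ 2 := by linarith
  apply Complex.ext
  · simp only [Complex.add_re, Complex.one_re, Complex.ofReal_re, Complex.mul_re, Complex.I_re,
      Complex.ofReal_im, Complex.I_im, Complex.mul_im, Complex.sub_re, Complex.sub_im, Complex.one_im,
      Complex.add_im, mul_zero, zero_mul, sub_zero, add_zero, mul_one, zero_sub, zero_add]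
    field_simp
    rw [hcs']
    ring
  · simp only [Complex.add_re, Complex.one_re, Complex.ofReal_re, Complex.mul_re, Complex.I_re,
      Complex.ofReal_im, Complex.I_im, Complex.mul_im, Complex.sub_re, Complex.sub_im, Complex.one_im,
      Complex.add_im, mul_zero, zero_mul, sub_zero, add_zero, mul_one, zero_sub, zero_add]
    field_simp
    rw [hcs']
    ring

/-- Derivative of the boundary parametrisation `θ ↦ x cot(θ/2)`: `-x / (2 sin²(θ/2))`.
[folklore] -/
theorem hasDerivAt_mul_cot_half (x θ : ℝ) (hθ : Real.sin (θ / 2) ≠ 0) :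
    HasDerivAt (fun θ : ℝ => x * (Real.cos (θ / 2) / Real.sin (θ / 2)))
      (-x / (2 * Real.sin (θ / 2) ^ 2)) θ := by
  have h1 : HasDerivAt (fun θ : ℝ => θ / 2) (1 / 2) θ := by
    simpa using (hasDerivAt_id θ).div_const 2
  have hq := ((h1.cos).div (h1.sin) hθ).const_mul x
  refine hq.congr_deriv ?_
  have hcs : Real.sin (θ / 2) ^ 2 + Real.cos (θ / 2) ^ 2 = 1 := Real.sin_sq_add_cos_sq _
  field_simp
  linear_combination (-x) * hcs

/-- **The half-plane Poisson kernel as the image of arc length**: under `y = x cot(θ/2)`,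
`θ ∈ (0, 2π)`, one has `dθ = 2x (x² + y²)⁻¹ dy`, i.e.
`∫₀^{2π} F(x cot(θ/2)) dθ = ∫_ℝ F(y) · 2x/(x²+y²) dy` for every `F : ℝ → [0, ∞]`
(change of variables for the injective smooth map, `lintegral_image_eq_lintegral_abs_deriv_mul`).
[folklore] -/
theorem lintegral_cayley_subst (x : ℝ) (hx : 0 < x) (F : ℝ → ℝ≥0∞) :
    ∫⁻ θ in Ioo (0:ℝ) (2 * π), F (x * (Real.cos (θ / 2) / Real.sin (θ / 2))) =
      ∫⁻ y, F y * ENNReal.ofReal (2 * x / (x ^ 2 + y ^ 2)) := by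
  set f : ℝ → ℝ := fun θ => x * (Real.cos (θ / 2) / Real.sin (θ / 2)) with hf
  set f' : ℝ → ℝ := fun θ => -x / (2 * Real.sin (θ / 2) ^ 2) with hf'
  have hsin : ∀ θ ∈ Ioo (0:ℝ) (2 * π), Real.sin (θ / 2) ≠ 0 := by
    intro θ hθ
    exact (Real.sin_pos_of_pos_of_lt_pi (by linarith [hθ.1]) (by linarith [hθ.2])).ne'
  have hderiv : ∀ θ ∈ Ioo (0:ℝ) (2 * π), HasDerivWithinAt f (f' θ) (Ioo (0:ℝ) (2 * π)) θ :=
    fun θ hθ => (hasDerivAt_mul_cot_half x θ (hsin θ hθ)).hasDerivWithinAt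
  have hcont : ContinuousOn f (Ioo (0:ℝ) (2 * π)) := fun θ hθ =>
    (hasDerivAt_mul_cot_half x θ (hsin θ hθ)).continuousAt.continuousWithinAt
  have hanti : StrictAntiOn f (Ioo (0:ℝ) (2 * π)) := by
    refine strictAntiOn_of_deriv_neg (convex_Ioo _ _) hcont fun θ hθ => ?_
    rw [interior_Ioo] at hθ
    rw [(hasDerivAt_mul_cot_half x θ (hsin θ hθ)).deriv]
    have : 0 < 2 * Real.sin (θ / 2) ^ 2 := by positivity [hsin θ hθ]
    exact div_neg_of_neg_of_pos (by linarith) this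
  have hinj : InjOn f (Ioo (0:ℝ) (2 * π)) := hanti.injOn
  have himage : f '' Ioo (0:ℝ) (2 * π) = univ := by
    refine eq_univ_of_forall fun y => ?_
    set t := Real.arctan (y / x) with ht
    have ht1 : -(π / 2) < t := Real.neg_pi_div_two_lt_arctan _
    have ht2 : t < π / 2 := Real.arctan_lt_pi_div_two _
    refine ⟨π - 2 * t, ⟨by linarith, by linarith⟩, ?_⟩
    simp only [hf]
    have h2 : (π - 2 * t) / 2 = π / 2 - t := by ring
    rw [h2, Real.cos_pi_div_two_sub, Real.sin_pi_div_two_sub, ← Real.tan_eq_sin_div_cos, ht,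
      Real.tan_arctan]
    field_simp
  have key := lintegral_image_eq_lintegral_abs_deriv_mul measurableSet_Ioo hderiv hinj
    (fun y => F y * ENNReal.ofReal (2 * x / (x ^ 2 + y ^ 2)))
  rw [himage, Measure.restrict_univ] at key
  rw [key]
  refine setLIntegral_congr_fun measurableSet_Ioo fun θ hθ => ?_
  have hs := hsin θ hθ
  have hone : |f' θ| * (2 * x / (x ^ 2 + f θ ^ 2)) = 1 := by
    simp only [hf, hf']
    rw [abs_div, abs_neg, abs_of_pos hx, abs_of_pos (by positivity)]
    have hcs : Real.sin (θ / 2) ^ 2 + Real.cos (θ / 2) ^ 2 = 1 := Real.sin_sq_add_cos_sq _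
    field_simp
    linear_combination (-1 : ℝ) * hcs
  rw [mul_left_comm, ← ENNReal.ofReal_mul (abs_nonneg _), hone, ENNReal.ofReal_one, mul_one]

/-- The Cayley map has nonnegative real part on the closed unit disc minus `1`:
`Re((1+ζ)/(1-ζ)) = (1 - |ζ|²)/|1-ζ|²`. [folklore] -/
theorem re_cayley_nonneg {ζ : ℂ} (hζ : ‖ζ‖ ≤ 1) (h1 : ζ ≠ 1) : 0 ≤ ((1 + ζ) / (1 - ζ)).re := by
  have hd : (1:ℂ) - ζ ≠ 0 := sub_ne_zero.mpr (Ne.symm h1)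
  have hns : 0 < Complex.normSq (1 - ζ) := Complex.normSq_pos.mpr hd
  have hsq : ζ.re ^ 2 + ζ.im ^ 2 ≤ 1 := by
    have h := Complex.normSq_eq_norm_sq ζ
    rw [Complex.normSq_apply] at h
    nlinarith [norm_nonneg ζ]
  rw [Complex.div_re]
  simp only [Complex.add_re, Complex.one_re, Complex.sub_re, Complex.add_im, Complex.one_im,
    Complex.sub_im, zero_add, zero_sub]
  rw [← add_div]
  apply div_nonneg _ hns.le
  nlinarith

/-- **Boundary minorisation of a subharmonic function in the right half-plane by its Poisson
integral, in the limit form needed for the Kramers–Kronig floor.**  Let `u ≤ 0` on the closed right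
half-plane, `u(x) ≥ -xβ` on the positive axis, and suppose that each Cayley pull-back
`ζ ↦ u(x(1+ζ)/(1-ζ))`, `x > 0`, is subharmonic off the pole `ζ = 1`. Then
`∫ (-u(iy)) y⁻² dy ≤ πβ`. Proof: sub-mean-value at the centre of the circles `|ζ| = r < 1`, Fatou
as `r → 1` using upper semicontinuity at the boundary, the change of variables `y = x cot(θ/2)`
(`dθ = 2x (x²+y²)⁻¹ dy`, the Poisson kernel of the half-plane), and monotone convergence `x ↓ 0`.
(Ransford, Potential Theory in the Complex Plane, §2.3–2.4; the half-plane Poisson kernel.)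
[folklore] -/
theorem lintegral_boundary_le_of_subharmonic (u : ℂ → EReal) (β : ℝ)
    (h0 : ∀ z : ℂ, 0 ≤ z.re → u z ≤ 0)
    (hx : ∀ x : ℝ, 0 < x → ((-(x * β) : ℝ) : EReal) ≤ u x)
    (hsub : ∀ x : ℝ, 0 < x →
      IsSubharmonicOn (fun ζ => u ((x : ℂ) * ((1 + ζ) / (1 - ζ)))) {ζ | ζ ≠ 1})
    (hmeas : Measurable fun y : ℝ => u (I * y)) :
    ∫⁻ y : ℝ, (-u (I * y)).toENNReal * ENNReal.ofReal (1 / y ^ 2) ≤ ENNReal.ofReal (π * β) := by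
  set H : ℝ → ℝ≥0∞ := fun y => (-u (I * y)).toENNReal with hH
  have hHmeas : Measurable H := hmeas.neg.ereal_toENNReal
  have hsin : ∀ θ ∈ Ioo (0:ℝ) (2 * π), Real.sin (θ / 2) ≠ 0 := by
    intro θ hθ
    exact (Real.sin_pos_of_pos_of_lt_pi (by linarith [hθ.1]) (by linarith [hθ.2])).ne'
  -- Step A: the Poisson-kernel bound at height `x > 0`
  have stepA : ∀ x : ℝ, 0 < x →
      ∫⁻ y, H y * ENNReal.ofReal (2 * x / (x ^ 2 + y ^ 2)) ≤ ENNReal.ofReal (2 * π * x * β) := by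
    intro x hx0
    set w : ℂ → EReal := fun ζ => u ((x : ℂ) * ((1 + ζ) / (1 - ζ))) with hw_def
    have hw : IsSubharmonicOn w {ζ | ζ ≠ 1} := hsub x hx0
    have hw0 : ∀ ζ : ℂ, ‖ζ‖ ≤ 1 → ζ ≠ 1 → w ζ ≤ 0 := by
      intro ζ hζ h1
      refine h0 _ ?_
      rw [Complex.re_ofReal_mul]
      exact mul_nonneg hx0.le (re_cayley_nonneg hζ h1)
    have hmemU : ∀ r : ℝ, 0 ≤ r → r < 1 → ∀ θ : ℝ, circleMap 0 r θ ∈ {ζ : ℂ | ζ ≠ 1} := by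
      intro r hr hr1 θ h1
      have : ‖circleMap 0 r θ‖ = 1 := by rw [show circleMap 0 r θ = 1 from h1]; simp
      rw [circleMap_zero, norm_mul, Complex.norm_real, Real.norm_eq_abs, abs_of_nonneg hr,
        Complex.norm_exp_ofReal_mul_I, mul_one] at this
      linarith
    -- the lower-mean bound on every circle `|ζ| = r < 1`
    have hmean : ∀ r : ℝ, 0 < r → r < 1 →
        ∫⁻ θ in Ioc (0:ℝ) (2 * π), (-w (circleMap 0 r θ)).toENNReal ≤
          ENNReal.ofReal (2 * π * x * β) := by
      intro r hr hr1
      have hsub' : closedBall (0:ℂ) r ⊆ {ζ | ζ ≠ 1} := by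
        intro ζ hζ h1
        rw [mem_closedBall, dist_zero_right, show ζ = 1 from h1, norm_one] at hζ
        linarith
      have hmv := hw.le_circleMean hr hsub'
      have hw0' : w 0 = u x := by simp [hw_def]
      have hup : circleUpperMean w 0 r = 0 := by
        unfold circleUpperMean
        have : (fun θ : ℝ => (w (circleMap 0 r θ)).toENNReal) = fun _ => 0 := by
          funext θ
          refine EReal.toENNReal_of_nonpos (hw0 _ ?_ (hmemU r hr.le hr1 θ))
          rw [circleMap_zero, norm_mul, Complex.norm_real, Real.norm_eq_abs, abs_of_pos hr,
            Complex.norm_exp_ofReal_mul_I, mul_one]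
          exact hr1.le
        rw [this, lintegral_zero, ENNReal.zero_div]
      have hcm : circleMean w 0 r = -((circleLowerMean w 0 r : ℝ≥0∞) : EReal) := by
        rw [circleMean, hup]
        simp
      have h1 : ((circleLowerMean w 0 r : ℝ≥0∞) : EReal) ≤ ((x * β : ℝ) : EReal) := by
        have h := (hx x hx0).trans (hw0' ▸ hmv)
        rw [hcm, EReal.coe_neg, EReal.neg_le_neg_iff] at h
        exact h
      have h2 : circleLowerMean w 0 r ≤ ENNReal.ofReal (x * β) := by
        rcases le_or_gt 0 (x * β) with hxβ | hxβ
        · have : ((x * β : ℝ) : EReal) = ((ENNReal.ofReal (x * β) : ℝ≥0∞) : EReal) := by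
            rw [EReal.coe_ennreal_ofReal, max_eq_left hxβ]
          rw [this, EReal.coe_ennreal_le_coe_ennreal_iff] at h1
          exact h1
        · exfalso
          have h3 : (0 : EReal) ≤ ((circleLowerMean w 0 r : ℝ≥0∞) : EReal) := EReal.coe_ennreal_nonneg _
          have h4 : ((x * β : ℝ) : EReal) < 0 := by exact_mod_cast hxβ
          exact (lt_irrefl (0 : EReal)) ((h3.trans h1).trans_lt h4)
      unfold circleLowerMean at h2
      have hpi0 : ENNReal.ofReal (2 * π) ≠ 0 := (ENNReal.ofReal_pos.2 (by positivity)).ne'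
      rw [ENNReal.div_le_iff hpi0 ENNReal.ofReal_ne_top] at h2
      refine h2.trans_eq ?_
      rcases le_or_gt 0 (x * β) with hxβ | hxβ
      · rw [← ENNReal.ofReal_mul hxβ]
        congr 1
        ring
      · rw [ENNReal.ofReal_of_nonpos hxβ.le, zero_mul, ENNReal.ofReal_of_nonpos]
        nlinarith [Real.pi_pos]
    -- Fatou along `r_k → 1⁻`
    set rk : ℕ → ℝ := fun k => 1 - 1 / ((k : ℝ) + 2) with hrk_def
    have hrk : ∀ k, 0 < rk k ∧ rk k < 1 := by
      intro k
      have hk : (0:ℝ) < (k : ℝ) + 2 := by positivity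
      constructor
      · simp only [hrk_def]
        rw [sub_pos, div_lt_one hk]
        linarith
      · simp only [hrk_def]
        have : 0 < 1 / ((k : ℝ) + 2) := by positivity
        linarith
    have hrk_lim : Tendsto rk atTop (𝓝 1) := by
      have h1 : Tendsto (fun k : ℕ => 1 / ((k : ℝ) + 2)) atTop (𝓝 0) := by
        have := tendsto_one_div_add_atTop_nhds_zero_nat (𝕜 := ℝ)
        have h2 : Tendsto (fun k : ℕ => k + 1) atTop atTop := tendsto_add_atTop_nat 1
        have h3 := this.comp h2
        refine h3.congr fun k => ?_
        simp only [Function.comp_apply]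
        push_cast
        ring_nf
      have : Tendsto (fun k : ℕ => (1:ℝ) - 1 / ((k : ℝ) + 2)) atTop (𝓝 (1 - 0)) :=
        tendsto_const_nhds.sub h1
      rw [sub_zero] at this
      exact this
    set G : ℕ → ℝ → ℝ≥0∞ := fun k θ => (-w (circleMap 0 (rk k) θ)).toENNReal with hG_def
    have hGmeas : ∀ k, Measurable (G k) := fun k =>
      (measurable_comp_circleMap hw.1 (hmemU (rk k) (hrk k).1.le (hrk k).2)).neg.ereal_toENNReal
    have hfatou : ∫⁻ θ in Ioc (0:ℝ) (2 * π), liminf (fun k => G k θ) atTop ≤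
        liminf (fun k => ∫⁻ θ in Ioc (0:ℝ) (2 * π), G k θ) atTop :=
      lintegral_liminf_le hGmeas
    have hbound : liminf (fun k => ∫⁻ θ in Ioc (0:ℝ) (2 * π), G k θ) atTop ≤
        ENNReal.ofReal (2 * π * x * β) :=
      Filter.liminf_le_of_frequently_le'
        (Eventually.of_forall fun k => hmean (rk k) (hrk k).1 (hrk k).2).frequently
    -- pointwise lower bound of the `liminf` by the boundary values (u.s.c. at the boundary)
    have hpt : ∀ θ ∈ Ioo (0:ℝ) (2 * π),
        (-w (circleMap 0 1 θ)).toENNReal ≤ liminf (fun k => G k θ) atTop := by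
      intro θ hθ
      set ζ₀ : ℂ := circleMap 0 1 θ with hζ₀_def
      have hζ₀ : ζ₀ ≠ 1 := by
        intro h1
        rw [hζ₀_def, circleMap_zero, Complex.ofReal_one, one_mul, Complex.exp_eq_one_iff] at h1
        obtain ⟨n, hn⟩ := h1
        have hθn : θ = n * (2 * π) := by
          have := congrArg Complex.im hn
          simpa using this
        have h1' : (0:ℝ) < n := by
          have : (0:ℝ) < n * (2 * π) := hθn ▸ hθ.1
          nlinarith [Real.pi_pos]
        have h2' : (n:ℝ) < 1 := by
          have : n * (2 * π) < 1 * (2 * π) := by rw [one_mul]; exact hθn ▸ hθ.2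
          nlinarith [Real.pi_pos]
        have h3 : (0:ℤ) < n := by exact_mod_cast h1'
        have h4 : n < (1:ℤ) := by exact_mod_cast h2'
        omega
      have husc : UpperSemicontinuousWithinAt w {ζ | ζ ≠ 1} ζ₀ := hw.1 ζ₀ hζ₀
      have htend : Tendsto (fun k => circleMap 0 (rk k) θ) atTop (𝓝[{ζ | ζ ≠ 1}] ζ₀) := by
        rw [tendsto_nhdsWithin_iff]
        constructor
        · have heq : (fun k => circleMap 0 (rk k) θ) = fun k => ((rk k : ℝ) : ℂ) * exp (θ * I) :=
            funext fun k => by rw [circleMap_zero]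
          have hζ : ζ₀ = ((1:ℝ) : ℂ) * exp (θ * I) := by rw [hζ₀_def, circleMap_zero, Complex.ofReal_one]
          rw [heq, hζ]
          exact ((Complex.continuous_ofReal.tendsto 1).comp hrk_lim).mul_const _
        · exact Eventually.of_forall fun k => hmemU (rk k) (hrk k).1.le (hrk k).2 θ
      have hlimsup : limsup (fun k => w (circleMap 0 (rk k) θ)) atTop ≤ w ζ₀ := by
        refine le_of_forall_gt_imp_ge_of_dense fun a ha => ?_
        exact Filter.limsup_le_of_le (by isBoundedDefault)
          ((htend.eventually (husc a ha)).mono fun k hk => hk.le)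
      have hφ : (-w ζ₀).toENNReal ≤
          (-(limsup (fun k => w (circleMap 0 (rk k) θ)) atTop)).toENNReal :=
        EReal.toENNReal_le_toENNReal (EReal.neg_le_neg_iff.mpr hlimsup)
      refine hφ.trans_eq ?_
      have hanti : Antitone fun x : EReal => (-x).toENNReal := fun x y h =>
        EReal.toENNReal_le_toENNReal (EReal.neg_le_neg_iff.mpr h)
      have := hanti.map_limsup_of_continuousAt (F := atTop)
        (fun k => w (circleMap 0 (rk k) θ))
        (EReal.continuous_toENNReal.comp continuous_neg).continuousAt
      simpa [Function.comp_def] using this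
    -- boundary identification
    have hbdry : ∀ θ ∈ Ioo (0:ℝ) (2 * π),
        w (circleMap 0 1 θ) = u (I * ((x * (Real.cos (θ / 2) / Real.sin (θ / 2)) : ℝ) : ℂ)) := by
      intro θ hθ
      simp only [hw_def, circleMap_zero, Complex.ofReal_one, one_mul]
      rw [cayley_boundary θ (hsin θ hθ)]
      push_cast
      ring_nf
    -- assemble
    calc ∫⁻ y, H y * ENNReal.ofReal (2 * x / (x ^ 2 + y ^ 2))
        = ∫⁻ θ in Ioo (0:ℝ) (2 * π), H (x * (Real.cos (θ / 2) / Real.sin (θ / 2))) :=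
          (lintegral_cayley_subst x hx0 H).symm
      _ = ∫⁻ θ in Ioo (0:ℝ) (2 * π), (-w (circleMap 0 1 θ)).toENNReal :=
          setLIntegral_congr_fun measurableSet_Ioo fun θ hθ => by rw [hbdry θ hθ]
      _ ≤ ∫⁻ θ in Ioo (0:ℝ) (2 * π), liminf (fun k => G k θ) atTop :=
          setLIntegral_mono' measurableSet_Ioo hpt
      _ ≤ ∫⁻ θ in Ioc (0:ℝ) (2 * π), liminf (fun k => G k θ) atTop :=
          lintegral_mono' (Measure.restrict_mono Ioo_subset_Ioc_self le_rfl) le_rfl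
      _ ≤ liminf (fun k => ∫⁻ θ in Ioc (0:ℝ) (2 * π), G k θ) atTop := hfatou
      _ ≤ ENNReal.ofReal (2 * π * x * β) := hbound
  -- Step B: divide by `2x`
  have stepB : ∀ x : ℝ, 0 < x →
      ∫⁻ y, H y * ENNReal.ofReal (1 / (x ^ 2 + y ^ 2)) ≤ ENNReal.ofReal (π * β) := by
    intro x hx0
    have hA := stepA x hx0
    have heq : ∫⁻ y, H y * ENNReal.ofReal (2 * x / (x ^ 2 + y ^ 2)) =
        ENNReal.ofReal (2 * x) * ∫⁻ y, H y * ENNReal.ofReal (1 / (x ^ 2 + y ^ 2)) := by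
      rw [← lintegral_const_mul' _ _ ENNReal.ofReal_ne_top]
      refine lintegral_congr fun y => ?_
      rw [mul_left_comm, ← ENNReal.ofReal_mul (by positivity)]
      congr 2
      field_simp
    rw [heq, show ENNReal.ofReal (2 * π * x * β) = ENNReal.ofReal (2 * x) * ENNReal.ofReal (π * β) by
      rw [← ENNReal.ofReal_mul (by positivity)]; congr 1; ring] at hA
    exact (ENNReal.mul_le_mul_iff_right ((ENNReal.ofReal_pos.2 (by positivity)).ne') ENNReal.ofReal_ne_top).mp hA
  -- Step C: monotone convergence `x = 1/(k+1) → 0`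
  set xk : ℕ → ℝ := fun k => 1 / ((k : ℝ) + 1) with hxk_def
  have hxk : ∀ k, 0 < xk k := fun k => by positivity
  have hC : ∀ k : ℕ, ∫⁻ y, H y * ENNReal.ofReal (1 / (xk k ^ 2 + y ^ 2)) ≤ ENNReal.ofReal (π * β) :=
    fun k => stepB (xk k) (hxk k)
  have hmono : ∀ y : ℝ, Monotone fun k : ℕ => ENNReal.ofReal (1 / (xk k ^ 2 + y ^ 2)) := by
    intro y k l hkl
    refine ENNReal.ofReal_le_ofReal (one_div_le_one_div_of_le (by positivity [hxk l]) ?_)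
    have h1 : xk l ≤ xk k := by
      simp only [hxk_def]
      exact one_div_le_one_div_of_le (by positivity) (by exact_mod_cast Nat.add_le_add_right hkl 1)
    nlinarith [hxk l, hxk k]
  have hpt2 : ∀ y : ℝ, H y * ENNReal.ofReal (1 / y ^ 2) ≤
      ⨆ k : ℕ, H y * ENNReal.ofReal (1 / (xk k ^ 2 + y ^ 2)) := by
    intro y
    by_cases hy : y = 0
    · simp [hy]
    · rw [← ENNReal.mul_iSup]
      gcongr
      have hxlim : Tendsto xk atTop (𝓝 0) := by
        simpa [hxk_def] using tendsto_one_div_add_atTop_nhds_zero_nat (𝕜 := ℝ)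
      have hlim : Tendsto (fun k : ℕ => ENNReal.ofReal (1 / (xk k ^ 2 + y ^ 2))) atTop
          (𝓝 (ENNReal.ofReal (1 / y ^ 2))) := by
        refine ENNReal.tendsto_ofReal ?_
        have : Tendsto (fun k : ℕ => xk k ^ 2 + y ^ 2) atTop (𝓝 (0 ^ 2 + y ^ 2)) :=
          (hxlim.pow 2).add tendsto_const_nhds
        have h2 := this.inv₀ (by positivity : (0:ℝ) ^ 2 + y ^ 2 ≠ 0)
        simp only [one_div]
        simpa using h2
      exact le_of_eq (tendsto_nhds_unique hlim (tendsto_atTop_iSup (hmono y)))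
  have hmeasF : ∀ k, Measurable fun y : ℝ => H y * ENNReal.ofReal (1 / (xk k ^ 2 + y ^ 2)) := by
    intro k
    refine hHmeas.mul (ENNReal.measurable_ofReal.comp ?_)
    exact (measurable_const.div ((measurable_const).add (measurable_id.pow_const 2)))
  calc ∫⁻ y, H y * ENNReal.ofReal (1 / y ^ 2)
      ≤ ∫⁻ y, ⨆ k : ℕ, H y * ENNReal.ofReal (1 / (xk k ^ 2 + y ^ 2)) := lintegral_mono hpt2
    _ = ⨆ k : ℕ, ∫⁻ y, H y * ENNReal.ofReal (1 / (xk k ^ 2 + y ^ 2)) :=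
        lintegral_iSup hmeasF fun k l hkl y => mul_le_mul_right (hmono y hkl) _
    _ ≤ ENNReal.ofReal (π * β) := iSup_le hC


end Literature.Analysis.Potential
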